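import Summits.ResolutionOfSingularities.ResolutionOfSingularities.Theorems.EquisingularLiftEquisingularLiftNatCentredPackageFrame
import Literature.AlgebraicGeometry.Resolution.PrimeDivisorIdeals
import Literature.AlgebraicGeometry.Resolution.HypersurfaceRestriction
import Literature.AlgebraicGeometry.Resolution.MarkedIdealsLemmas
import HarnessLib

/-!
# [OURS · L1 W4.5(b) · EL♮(3)] B6c ★ T-PKG-FRAME (2/2): the centred package at the cone point in the currency of res-D-pv-029's B6b
# glue `exists_axisSection_conePoint` — the cone's strict transform lies in the kernel of the axis section automatically
# (crux `EquisingularLiftNatThree` stmt-ResolutionOfSingularities-20148 / parent 20038; rung v7 TC⁺, brick `inv_base`, B8's clause (vi))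

NOT a statement of any manuscript. Helper file of the chain res-L1-w45b (cell `res-hironaka`, LADDER-RESOLUTION rung L, slot W4.5(b));
OURS; AI-written, weaker than expert review; `--supports stmt-ResolutionOfSingularities-20148 --as helper` by res-L1-w45b-stub-3 (object B6c ★
T-PKG-FRAME). No `sorry`; standard axioms. It closes nothing by itself.

WHAT. Part 1 (…NatCentredPackageFrame, `tcPlus_centredPackage_of_presentation`, p545513) asks for `J·𝒪_{X₁} ⊔ St K₀ ≤ ker s_c`; res-D-pv-029's
B6b glue (…NatAxisSectionConePoint, p545343) delivers the axis section with `C_axis ≤ ker s_c` only (`C_axis = J·𝒪_{X₁} ⊔ St L₁ ⊔ St L₂`).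
The missing containment `St K₀ ≤ ker s_c` is LOCAL AT THE CLOSED POINT of the section:

* **`le_ker_of_stalkIdeal_le_closedPoint`** — for a morphism `g : Spec O → X` from the spectrum of a local ring and an ideal sheaf `I` on
  `X`: `I_{g(s₀)} ⊆ (ker g)_{g(s₀)}` at the closed point `s₀` ALREADY gives `I ≤ ker g` (every point of `Spec O` specialises to `s₀`, stalks
  of ideal sheaves at a generisation are extensions — Literature `stalkIdeal_map_stalkSpecializes` — and `I ≤ ker g ⟺ g^* I = 0`,
  Literature `le_ker_iff_comap_eq_bot`, is checked on stalks, `le_of_forall_stalkIdeal_le`);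
* `eval_mem_span_range_of_isHomogeneous` — a form of degree `m ≥ 1` evaluates into the ideal of its arguments;
* **`tcPlus_centredPackage_of_axisSection`** — part 1 with the hypothesis `hle` REPLACED by `hE : J·𝒪_{X₁} ≤ ker s_c` (from B6b's
  `C_axis ≤ ker s_c`): `(St K₀)_{p₁} = (χ₁ Φ_R(c/c₀))` (res-type-100 F2′ p535966) is the value of the regrouped form of degree `m ≥ 1` at
  `(χ₁(c₁/c₀), χ₁(c₂/c₀))`, hence lies in `(c₀/1, c₁/c₀, c₂/c₀)·𝒪_{p₁} = (ker s_c)_{p₁}`.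

References: res-D-pv-029 …NatAxisSectionConePoint (p545343); res-type-100 F2′ (p535966); part 1 (p545513); Literature PrimeDivisorIdeals,
HypersurfaceRestriction, MarkedIdealsLemmas. H. Matsumura, *Commutative Ring Theory* (1986), Thm. 14.2 [cite: Matsumura1987].
-/

set_option linter.dupNamespace false -- mandated namespace `Summit.<Summit>.<Problem>` of this single-conjunct summit
set_option linter.overlappingInstances false -- signatures carry `[IsDomain O] [IsDiscreteValuationRing O]`

noncomputable section

open CategoryTheory CategoryTheory.Limits AlgebraicGeometry TopologicalSpace IsLocalRing
open Literature.AlgebraicGeometry.Resolution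
open AlgebraicGeometry.Scheme.IdealSheafData

namespace Summit.ResolutionOfSingularities.ResolutionOfSingularities.Cruxes.EquisingularLiftNat.Sections.TCPlus

/-- **An ideal sheaf lies in the kernel of a morphism from the spectrum of a local ring as soon as its stalk at the image of the closed
point lies in the kernel's stalk there.** [cite: StacksProject, Tag 01HR] [folklore] -/
theorem le_ker_of_stalkIdeal_le_closedPoint {O : Type} [CommRing O] [IsLocalRing O] {X : Scheme.{0}} (g : Spec (.of O) ⟶ X)
    (I : X.IdealSheafData) (h : stalkIdeal I (g (closedPoint O)) ≤ stalkIdeal g.ker (g (closedPoint O))) : I ≤ g.ker := by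
  rw [le_ker_iff_comap_eq_bot]
  have hker : g.ker.comap g = ⊥ := (le_ker_iff_comap_eq_bot g g.ker).mp le_rfl
  refine le_bot_iff.mp ?_
  rw [← hker]
  refine le_of_forall_stalkIdeal_le fun t => ?_
  rw [stalkIdeal_comap_eq_map_stalkMap, stalkIdeal_comap_eq_map_stalkMap]
  refine Ideal.map_mono ?_
  have hgt : g t ⤳ g (closedPoint O) := (IsLocalRing.specializes_closedPoint t).map g.continuous
  rw [← stalkIdeal_map_stalkSpecializes I hgt, ← stalkIdeal_map_stalkSpecializes g.ker hgt]
  exact Ideal.map_mono h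

/-- A form of degree `m ≥ 1` evaluates into the ideal generated by its arguments. [folklore] -/
theorem eval_mem_span_range_of_isHomogeneous {A : Type*} [CommRing A] {n m : ℕ} (u : Fin n → A) {Φ : MvPolynomial (Fin n) A}
    (hΦ : Φ.IsHomogeneous m) (hm : 1 ≤ m) : MvPolynomial.eval u Φ ∈ Ideal.span (Set.range u) :=
  Ideal.pow_le_self (Nat.one_le_iff_ne_zero.mp hm) ((Ideal.mem_span_pow_iff_exists_isHomogeneous u _).mpr ⟨Φ, hΦ, rfl⟩)

set_option maxHeartbeats 800000 in -- chart algebra of a stalk = subalgebra of a localisation: slow instance unification (as p540528)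
/-- **B6c ★ T-PKG-FRAME in the currency of the B6b glue**: as `tcPlus_centredPackage_of_presentation` (part 1), with the containment
hypothesis reduced to `J·𝒪_{X₁} ≤ ker s_c` — the cone's strict transform lies in `ker s_c` because its stalk at `p₁` is the value of a form of
degree `m ≥ 1` in `(χ₁(c₁/c₀), χ₁(c₂/c₀))`, inside `(ker s_c)_{p₁} = (χ₁(c₀/1), χ₁(c₁/c₀), χ₁(c₂/c₀))` (`le_ker_of_stalkIdeal_le_closedPoint`).
[cite: Matsumura1987, Thm. 14.2] [OURS · L1 W4.5b] B6c for res-type-100's B8 / B9; NOT a statement of the manuscript. -/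
theorem tcPlus_centredPackage_of_axisSection (O : Type) [CommRing O] [IsDomain O] [IsDiscreteValuationRing O] (ϖ : O)
    (hϖ : Irreducible ϖ) (P : Scheme.{0}) (q : P ⟶ Spec (.of O)) {X' X₁ : Scheme.{0}} [IsLocallyNoetherian X₁] (σ' : X' ⟶ P)
    (r' : X' ⟶ Spec (.of O)) {J : X'.IdealSheafData} {τ₁ : X₁ ⟶ X'} [IsSeparated ((τ₁ ≫ σ') ≫ q)] (K₀ : X'.IdealSheafData)
    (p₁ : X₁) (p : X') (hpc : τ₁ p₁ = p) (hpJ : p ∈ (J.support : Set X'))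
    (c : Fin 3 → X'.presheaf.stalk p) (hcJ : Ideal.span (Set.range c) = stalkIdeal J p) (hc : IsQuasiRegular c)
    (θR : (X'.presheaf.stalk p ⧸ Ideal.span (Set.range c)) ≃+* O)
    (hθR : ∀ b : O, θR (Ideal.Quotient.mk _
      (((Scheme.ΓSpecIso (.of O)).inv ≫ r'.appTop ≫ X'.presheaf.Γgerm p).hom b)) = b)
    (h𝔪R : Ideal.span (Set.range c) ⊔ Ideal.span {((Scheme.ΓSpecIso (.of O)).inv ≫ r'.appTop ≫ X'.presheaf.Γgerm p).hom ϖ} =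
      maximalIdeal (X'.presheaf.stalk p))
    (𝔔₁ : PrimeSpectrum (blowupAlgebra (Ideal.span (Set.range c)) (c 0)))
    (χ₁ : blowupAlgebra (Ideal.span (Set.range c)) (c 0) →+* X₁.presheaf.stalk p₁)
    (hχ₁ : ∀ a, χ₁ (algebraMap _ _ a) = ((X'.presheaf.stalkCongr (Inseparable.of_eq hpc)).inv ≫ τ₁.stalkMap p₁).hom a)
    (hloc₁ : @IsLocalization.AtPrime _ _ (X₁.presheaf.stalk p₁) _ χ₁.toAlgebra 𝔔₁.asIdeal _)
    (h𝔔₁ : 𝔔₁.asIdeal.comap (algebraMap _ (blowupAlgebra (Ideal.span (Set.range c)) (c 0))) = maximalIdeal (X'.presheaf.stalk p))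
    (hu : ∀ l : Fin 3, l ≠ 0 → χ₁ (blowupAlgebra.frac c 0 l) ∈ maximalIdeal (X₁.presheaf.stalk p₁))
    (hreg₁ : IsRegularLocalRing (X₁.presheaf.stalk p₁))
    (hdim₁ : ringKrullDim (X₁.presheaf.stalk p₁) = ((3 + 1 : ℕ) : WithBot ℕ∞))
    -- the axis section: res-D-pv-029's `exists_axisSection_conePoint` outputs (`hE` from its `C_axis ≤ s_c.ker`)
    (sc : Spec (.of O) ⟶ X₁) (hsc : sc ≫ (τ₁ ≫ σ') ≫ q = 𝟙 _) (hscp : sc (closedPoint O) = p₁)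
    (hE : J.comap τ₁ ≤ sc.ker)
    (hker : stalkIdeal sc.ker p₁ = (Ideal.span {algebraMap _ (blowupAlgebra (Ideal.span (Set.range c)) (c 0)) (c 0)} ⊔
      Ideal.span {blowupAlgebra.frac c 0 1, blowupAlgebra.frac c 0 2}).map χ₁)
    {d m : ℕ} (Φ : MvPolynomial (Fin 3) O) (h1m : 1 ≤ m) (hΦd : Φ.IsHomogeneous d) (hcen : ∀ α ∈ Φ.support, m ≤ α 1 + α 2)
    (hexact : ∃ α ∈ Φ.support, α 1 + α 2 = m ∧ Φ.coeff α ∉ maximalIdeal O)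
    (hΦc : MvPolynomial.map (Ideal.Quotient.mk (Ideal.span (Set.range c)))
      (MvPolynomial.map ((Scheme.ΓSpecIso (.of O)).inv ≫ r'.appTop ≫ X'.presheaf.Γgerm p).hom Φ) ≠ 0)
    (hK₀ : stalkIdeal K₀ p = Ideal.span {MvPolynomial.eval c
      (MvPolynomial.map ((Scheme.ΓSpecIso (.of O)).inv ≫ r'.appTop ≫ X'.presheaf.Γgerm p).hom Φ)})
    (Φu Φv : MvPolynomial (Fin 2) O)
    (hΦu : MvPolynomial.aeval (![1, MvPolynomial.X 0, MvPolynomial.X 0 * MvPolynomial.X 1] : Fin 3 → MvPolynomial (Fin 2) O) Φ =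
      MvPolynomial.X 0 ^ m * Φu)
    (hΦv : MvPolynomial.aeval (![1, MvPolynomial.X 0 * MvPolynomial.X 1, MvPolynomial.X 1] : Fin 3 → MvPolynomial (Fin 2) O) Φ =
      MvPolynomial.X 1 ^ m * Φv)
    (hregu : ∀ (Q : Ideal (MvPolynomial (Fin 2) O ⧸ Ideal.span {Φu})) [Q.IsPrime],
      Ideal.Quotient.mk (Ideal.span {Φu}) (MvPolynomial.C ϖ : MvPolynomial (Fin 2) O) ∈ Q → IsRegularLocalRing (Localization.AtPrime Q))
    (hregv : ∀ (Q : Ideal (MvPolynomial (Fin 2) O ⧸ Ideal.span {Φv})) [Q.IsPrime],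
      Ideal.Quotient.mk (Ideal.span {Φv}) (MvPolynomial.C ϖ : MvPolynomial (Fin 2) O) ∈ Q → IsRegularLocalRing (Localization.AtPrime Q)) :
    CentredPackage O P q X₁ (τ₁ ≫ σ') (J.comap τ₁) (strictTransformIdeal τ₁ J K₀) p₁ := by
  classical
  refine tcPlus_centredPackage_of_presentation O ϖ hϖ P q σ' r' K₀ p₁ p hpc hpJ c hcJ hc θR hθR h𝔪R 𝔔₁ χ₁ hχ₁ hloc₁ h𝔔₁ hu hreg₁
    hdim₁ sc hsc hscp (sup_le hE ?_) hker Φ h1m hΦd hcen hexact hΦc hK₀ Φu Φv hΦu hΦv hregu hregv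
  -- `St K₀ ≤ ker s_c`: its stalk at `p₁` is a value of a form of degree `m ≥ 1` in the chart coordinates
  haveI : IsDomain (X'.presheaf.stalk p ⧸ Ideal.span (Set.range c)) := MulEquiv.isDomain O θR.toMulEquiv
  set ι : O →+* X'.presheaf.stalk p := ((Scheme.ΓSpecIso (.of O)).inv ≫ r'.appTop ≫ X'.presheaf.Γgerm p).hom with hι
  obtain ⟨-, hSt, -, -⟩ := stalkIdeal_carrierDelta_of_presentation (τ := τ₁) K₀ p₁ p hpc hpJ c hcJ hc
    (MvPolynomial.map ι Φ) (hΦd.map ι) hΦc hK₀ 0 𝔔₁ χ₁ hχ₁ hloc₁ h𝔔₁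
  let u : Fin 2 → X₁.presheaf.stalk p₁ := fun l => χ₁ (blowupAlgebra.frac c 0 l.succ)
  have hu' : ∀ l : Fin 2, u l ∈ maximalIdeal (X₁.presheaf.stalk p₁) := fun l => hu l.succ (Fin.succ_ne_zero l)
  have hexact' : ∃ α ∈ Φ.support, α 1 + α 2 = m ∧
      IsUnit ((χ₁.comp ((algebraMap (X'.presheaf.stalk p) (blowupAlgebra (Ideal.span (Set.range c)) (c 0))).comp ι))
        (Φ.coeff α)) := by
    obtain ⟨α, hα, hαm, hαu⟩ := hexact
    exact ⟨α, hα, hαm, (IsLocalRing.notMem_maximalIdeal.mp hαu).map _⟩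
  obtain ⟨Φ', hΦ'd, hΦ'eval, -⟩ := exists_regroup_centred
    (χ₁.comp ((algebraMap (X'.presheaf.stalk p) (blowupAlgebra (Ideal.span (Set.range c)) (c 0))).comp ι)) u hu' Φ hΦd hcen hexact'
  have hfun : (fun i => χ₁ (blowupAlgebra.frac c 0 i)) = (![1, u 0, u 1] : Fin 3 → X₁.presheaf.stalk p₁) := by
    funext i
    refine Fin.cases ?_ (fun l => ?_) i
    · rw [show blowupAlgebra.frac c 0 0 = 1 from blowupAlgebra.gen_self _ _ _, map_one]
      rfl
    · have hl : l = 0 ∨ l = 1 := by fin_cases l <;> simp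
      rcases hl with rfl | rfl <;> rfl
  have hcone : MvPolynomial.eval u Φ' = χ₁ (MvPolynomial.aeval (blowupAlgebra.frac c 0) (MvPolynomial.map ι Φ)) := by
    rw [hΦ'eval, MvPolynomial.map_aeval, MvPolynomial.eval₂Hom_map_hom, hfun, MvPolynomial.aeval_def, MvPolynomial.eval₂_map,
      MvPolynomial.coe_eval₂Hom]
    exact congrArg (fun F => MvPolynomial.eval₂ F (![1, u 0, u 1] : Fin 3 → X₁.presheaf.stalk p₁) Φ) (RingHom.ext fun _ => rfl)
  refine le_ker_of_stalkIdeal_le_closedPoint sc _ ?_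
  rw [hscp, hSt, ← hcone, hker, Ideal.map_sup, Ideal.map_span, Ideal.map_span, Set.image_singleton, Set.image_pair,
    Ideal.span_singleton_le_iff_mem]
  refine Ideal.mem_sup_right ?_
  have hrange : Set.range u = {χ₁ (blowupAlgebra.frac c 0 1), χ₁ (blowupAlgebra.frac c 0 2)} := by
    ext a
    simp only [Set.mem_range, Set.mem_insert_iff, Set.mem_singleton_iff, u]
    constructor
    · rintro ⟨l, rfl⟩
      have hl : l = 0 ∨ l = 1 := by fin_cases l <;> simp
      rcases hl with rfl | rfl
      · exact Or.inl rfl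
      · exact Or.inr rfl
    · rintro (rfl | rfl)
      · exact ⟨0, rfl⟩
      · exact ⟨1, rfl⟩
  rw [← hrange]
  exact eval_mem_span_range_of_isHomogeneous u hΦ'd h1m

end Summit.ResolutionOfSingularities.ResolutionOfSingularities.Cruxes.EquisingularLiftNat.Sections.TCPlus

end
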